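import Summits.BirchSwinnertonDyer.Rank1Residual.X4.KuriharaLevelLowering
import Summits.BirchSwinnertonDyer.Rank1Residual.Additive.X4SharpThreeKimDefectParity
import Summits.BirchSwinnertonDyer.Rank1Residual.X4.KimTamagawaDefectUpper
import HarnessLib

/-!
# TAM-DEFECT₂♭ rows with `ord_p ∏ c ≤ 2` CLOSE from a level-lowering certificate: `∂^{(∞)}(δ̃) ≥ 1` (file `X4/KuriharaLevelLowering.lean`) fed into Kim (6) and the parity law (cell `b2b-bsdres`, seat additive-p4 gen 20, line V39; CLASS-CLOSURE §3.1 N11 / §3.2 N10, experiment types E2/E4)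

HONEST FRAMING (cell `b2b-bsdres`, verbatim in every file): the goal of the cell is to DELETE the
COMBINATION-SHAPED residual classes for ALL analytic-rank `≤ 1` curves over `ℚ` — "full BSD formula for
every rank `≤ 1` curve in class `C`" assembled STRICTLY from published theorems — so that the rank-`≤ 1`
remainder becomes exactly the CONSTRUCTION-SHAPED classes, which are TYPED (missing-input Props), NOT
attempted; this is not "finishing BSD". This file: research route on the CONSTRUCTION-shaped class X4
(additive `p`, `E[p]` irreducible); X4 stays CONSTRUCTION-SHAPED; labels unchanged; nothing booked; no
Literature fact minted; every `p = 3` statement is CONDITIONAL on the announced Kim 2025 clause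
(`Kim2025.thm11_kimShaLength_of_integralPeriod_OPEN`, flag `Kim2025-preprint`).

## What is here

The sibling `X4/KuriharaLevelLowering.lean` proves (kernel, pure algebra): a mod-`p` LEVEL-LOWERING
CERTIFICATE for the plus symbol of the newform `D.f` at a prime `ℓ ∣ N_E` (`PlusSymbolLevelLowersAt`)
forces EVERY mod-`p` Kurihara number to vanish, whence `1 ≤ ∂^{(∞)}(δ̃)` (`kuriharaPartialInfty`).
This file composes that `1` with the cell's published-input chains:

* §1 (`p ≥ 5`, PUBLISHED inputs only — Kim 2026 Thm. 1.8 (6) read as `hKimk`/`hE67c`, Cassels–Tate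
  `hCT`, GZK, modularity): on an X4 ∧ `r_an = 0` ∧ surj(`p`) row carrying a certificate,
  - `ord_p ∏_v c_v ≤ 1` ⟹ the `≥` half of Kim's Conjecture 1.10 and the UPPER half of `BSD(E,p)`
    WITHOUT Cassels–Tate (`kimTamagawaDefectGeAt_…`, `missingUpperBoundAt_…_of_tamagawa_le_one_…`);
  - `ord_p ∏_v c_v ≤ 2` and `ord_p #Ш_an` even ⟹ UPPER (`missingUpperBoundAt_…_of_tamagawa_le_two_…`);
  - **`ord_p ∏_v c_v ≤ 2` and `p ∤ #Ш_an` ⟹ `BSD(E,p)`** (`bsdp_of_plusSymbolLevelLowersAt_…`) — the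
    ONE-FACTOR SOCKET of `X4/KimDefectParity.lean` FILLED with `α = 1` by the certificate; census
    (seat file `V26-YIELD.tsv`): 175 of the 179 open TAM-DEFECT₂♭ unit rows of X4 ∧ r0 ∧ surj at
    `p ≥ 5` (window 2/2) have `ord_p ∏ c = 2`, so each of them closes on ONE finite mod-`p`
    linear-algebra certificate (two modular-symbol spaces, levels `N` and `N/ℓ`) instead of a statement
    over infinitely many Kolyvagin levels; the 4 rows with `ord_p ∏ c = 3` need `∂^{(∞)} ≥ 2`.
* §2 (`p ≥ 3` tower rows, CONDITIONAL on the preprint): the N11 twin — on a unit tower row with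
  `ord_p ∏_v c_v ≤ 2` the certificate gives `BSD(E,p)` modulo `Kim2025…_OPEN` (the 8 window
  TAM-DEFECT₂♭(3) rows with `ord₃ ∏ c = 2` all carry their Tamagawa `3`'s at split multiplicative
  primes `ℓ ≠ 3` or at a split `ℓ` plus an additive IV/IV* prime; kit jobs of this seat certify them).
* §3 instrument scope (class-free): under a certificate NO cyclic-level Kurihara number is a `p`-adic
  unit (`not_kuriharaUnitAt_…`) — the LOWER-half Kurihara instrument is blind at level `k = 1` on such
  rows (Mazur–Rubin Prop. 6.2.6's shadow; cf. the cell's candidate line P-TAM3), a theorem here.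
* §4 E1 prediction: on a certified unit row with `ord_p ∏ c ≤ 2` Kim's Conjecture 1.10 holds EXACTLY
  (`kimTamagawaDefectAt_…`, `kuriharaPartialInfty_eq_two_…`; `p ≥ 5` published, `p ≥ 3` modulo the
  preprint): all cyclic `δ̃_n` vanish mod `p²` at the levels `𝒩_2`, and one has valuation exactly `2`.

EVIDENCE (not used by the kernel): kit jobs j128507/j128706/j128708 of this seat — for the X4 rows
1050f1@5 (ℓ = 3), 1150e1@5 (2), 1275g1@5 (3), 1650q1@5 (3), 1666m1@7 (2), 738g1@3 (2), 11628f1@3 (17)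
the certificate HOLDS (mod-`p` eigen-subspace of dimension 1–4 in the `p`-saturated lattice, `w = 1`
the only solvable twist), and every computed Kurihara number `δ̃_n` (`ν(n) ≤ 2`) vanishes mod `p`.

## References

* C.-H. Kim, Amer. J. Math. 148 (2026), Thm. 1.8 (6), §1.5.1, Conj. 1.10, Rem. 6.2. [cite: Kim2022StructureSelmer, Thm. 1.9 (6) and Conj. 1.10 (PDF p. 8)]
* B. Mazur, K. Rubin, Mem. AMS 799 (2004), Prop. 6.2.6. [cite: MazurRubin2004, Prop. 6.2.6]
* J. Silverman, AEC (2009), Thm. X.4.14 (Cassels–Tate). [cite: SilvermanAEC2009, Thm. X.4.14]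
* R. L. Miller, LMS J. Comput. Math. 14 (2011), Def. 1.1. [cite: Miller2011LMS, Def. 1.1]
-/

noncomputable section

open scoped MatrixGroups ModularForm

open Complex CongruenceSubgroup WeierstrassCurve Literature.NumberTheory.EllipticCurves
  Literature.NumberTheory.EllipticCurves.ModularForms
  Literature.NumberTheory.EllipticCurves.Rank1Residual
  Literature.NumberTheory.EllipticCurves.Rank1Residual.Typed
  Summit.BirchSwinnertonDyer.Rank1Residual.LevelLowering

namespace Summit.BirchSwinnertonDyer.Rank1Residual.X4

variable (W : WeierstrassCurve ℚ) [W.IsElliptic] [W.IsGloballyMinimal] (p : ℕ) [Fact p.Prime]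

/-! ### §1 `p ≥ 5`: published inputs + the certificate -/

/-- **The `≥` half of Kim's Conjecture 1.10 on a row with `ord_p ∏_v c_v ≤ 1`, from a certificate**:
`p` odd, `E[p]` irreducible, conductor-level datum `D`, `PlusSymbolLevelLowersAt W p D.f ℓ` at some
`ℓ ∣ N_E` ⟹ `KimTamagawaDefectGeAt W p D.f` (`ord_p ∏ c ≤ 1 ≤ ∂^{(∞)}`). No Cassels–Tate, no Kim
fact: pure bookkeeping over the sibling's `one_le_kuriharaPartialInfty_…`.
[cite: Kim2022StructureSelmer, Conj. 1.10 (PDF p. 8)] -/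
theorem kimTamagawaDefectGeAt_of_plusSymbolLevelLowersAt_of_tamagawa_le_one
    (hp2 : p ≠ 2) (hirr : W.HasIrreducibleModPGaloisRep p)
    {N : ℕ} [NeZero N] (D : ModularParametrizationData W N) (hN : W.conductorNorm ℤ = N)
    {ℓ : ℕ} (hcert : PlusSymbolLevelLowersAt W p D.f ℓ) (hℓ : ℓ ∣ W.conductorNorm ℤ)
    (hc1 : padicValNat p W.tamagawaProduct ≤ 1) : KimTamagawaDefectGeAt W p D.f := by
  unfold KimTamagawaDefectGeAt
  calc (padicValNat p W.tamagawaProduct : ℕ∞) ≤ ((1 : ℕ) : ℕ∞) := by exact_mod_cast hc1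
    _ = 1 := Nat.cast_one
    _ ≤ kuriharaPartialInfty W p D.f :=
      one_le_kuriharaPartialInfty_of_plusSymbolLevelLowersAt hp2 hirr D hN hcert hℓ

/-- **UPPER half on the Tamagawa-defect-ONE rows WITHOUT Cassels–Tate**: `p ≥ 5`, analytic rank `0`,
`ρ̄_{E,p}` onto, conductor-level datum with `p ∤ c_D` and the period transfer, `ord_p ∏_v c_v ≤ 1`, and a
certificate ⟹ `MissingUpperBoundAt W p`. Inputs: Kim Thm. 1.8 (6) ∀-form (`hKim6`), GZK, modularity
(via `missingUpperBoundAt_of_kimTamagawaDefectGe`). The cell's earlier closure of these rows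
(`X4RankZeroKatoParity`, V23) used Cassels–Tate parity; this one does not.
[cite: Kim2022StructureSelmer, Thm. 1.9 (6) and Conj. 1.10 (PDF p. 8)] [cite: Miller2011LMS, Def. 1.1] -/
theorem missingUpperBoundAt_of_plusSymbolLevelLowersAt_of_tamagawa_le_one_of_five_le
    (hKim6 : Kim2026.rankZero_padicValNat_sha_add_le_of_forall_pow_dvd_kuriharaNumber_cyclicLevel)
    (hGZK : rank_eq_analyticRank_of_analyticRank_le_one) (hmod : hasEntireLFunction_rat)
    (hp : 5 ≤ p) (hr : W.analyticRank = 0) (hsurj : W.HasSurjectiveModNGaloisRep p)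
    {N : ℕ} [NeZero N] (D : ModularParametrizationData W N) (hN : W.conductorNorm ℤ = N)
    (hc : ¬ (p : ℤ) ∣ D.maninConstant)
    (hper : ∃ u : ℚ, ‖(u : ℚ_[p])‖ = 1 ∧ W.realPeriodRat = u * plusPeriod D.f)
    {ℓ : ℕ} (hcert : PlusSymbolLevelLowersAt W p D.f ℓ) (hℓ : ℓ ∣ W.conductorNorm ℤ)
    (hc1 : padicValNat p W.tamagawaProduct ≤ 1) : MissingUpperBoundAt W p :=
  missingUpperBoundAt_of_kimTamagawaDefectGe W p hKim6 hGZK hmod hp hr hsurj D hN hc hper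
    (kimTamagawaDefectGeAt_of_plusSymbolLevelLowersAt_of_tamagawa_le_one W p (by omega)
      (hasIrreducibleModPGaloisRep_of_hasSurjectiveModNGaloisRep W p hsurj) D hN hcert hℓ hc1)

/-- **UPPER half on rows with `ord_p ∏_v c_v ≤ 2` and `ord_p #Ш_an` even, from a certificate and the
PARITY LAW** (`p ≥ 5`; inputs `hKimk`, `hE67c`, Cassels–Tate `hCT`, GZK, modularity): `ord_p ∏ c ≤ 2
≤ ∂^{(∞)} + 1`, and parity forbids the one-off. [cite: Kim2022StructureSelmer, Thm. 1.9 (6) and Conj. 1.10 (PDF p. 8)]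
[cite: SilvermanAEC2009, Thm. X.4.14] [cite: Miller2011LMS, Def. 1.1] -/
theorem missingUpperBoundAt_of_plusSymbolLevelLowersAt_of_tamagawa_le_two_of_even_of_five_le
    (hKimk : Kim2026.rankZero_le_padicValNat_sha_of_kuriharaNumber_ne_zero)
    (hE67c : Kim2026.rankZero_padicValNat_sha_add_le_of_forall_pow_dvd_kuriharaNumber_cyclicLevel)
    (hCT : exists_casselsTate_pairing (K := ℚ))
    (hGZK : rank_eq_analyticRank_of_analyticRank_le_one) (hmod : hasEntireLFunction_rat)
    (hp : 5 ≤ p) (hr : W.analyticRank = 0) (hsurj : W.HasSurjectiveModNGaloisRep p)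
    {N : ℕ} [NeZero N] (D : ModularParametrizationData W N) (hN : W.conductorNorm ℤ = N)
    (hc : ¬ (p : ℤ) ∣ D.maninConstant)
    (hper : ∃ u : ℚ, ‖(u : ℚ_[p])‖ = 1 ∧ W.realPeriodRat = u * plusPeriod D.f)
    {q' : ℚ} (hq' : shaAn W = (q' : ℂ)) (hev : Even (padicValRat p q'))
    {ℓ : ℕ} (hcert : PlusSymbolLevelLowersAt W p D.f ℓ) (hℓ : ℓ ∣ W.conductorNorm ℤ)
    (hc2 : padicValNat p W.tamagawaProduct ≤ 2) : MissingUpperBoundAt W p := by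
  have h1 : (1 : ℕ∞) ≤ kuriharaPartialInfty W p D.f :=
    one_le_kuriharaPartialInfty_of_plusSymbolLevelLowersAt (by omega)
      (hasIrreducibleModPGaloisRep_of_hasSurjectiveModNGaloisRep W p hsurj) D hN hcert hℓ
  have hge : (padicValNat p W.tamagawaProduct : ℕ∞) ≤ kuriharaPartialInfty W p D.f + 1 :=
    calc (padicValNat p W.tamagawaProduct : ℕ∞) ≤ ((2 : ℕ) : ℕ∞) := by exact_mod_cast hc2
      _ = (1 : ℕ∞) + 1 := by norm_num
      _ ≤ kuriharaPartialInfty W p D.f + 1 := add_le_add h1 le_rfl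
  exact missingUpperBoundAt_of_tamagawa_le_kimDefect_add_one_of_even W p hKimk hE67c hCT hGZK hmod hp
    hr hsurj D hN hc hper hq' hev hge

/-- **THE TAM-DEFECT₂♭ CLOSURE at `p ≥ 5` (the one-factor socket FILLED with `α = 1`).** For `W/ℚ`
globally minimal of analytic rank `0`, `p ≥ 5` with `ρ̄_{E,p}` onto (ANY reduction at `p`, additive
included), a conductor-level datum `D` with `p ∤ c_D` and the period transfer, `#Ш_an(E) = q'` a
`p`-adic unit, **`ord_p ∏_v c_v ≤ 2`**, and a LEVEL-LOWERING CERTIFICATE for the mod-`p` plus symbol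
of `D.f` at some `ℓ ∣ N_E`: **`BSD(E,p)` holds.** Inputs: Kim 2026 Thm. 1.8 (6) (`hKimk`, `hE67c`, harvest-2
p249207/p250376), Cassels–Tate (`hCT`), GZK, modularity — all PUBLISHED — and the certificate
(per-pair EVIDENCE computed by the census, NOT a fact). Census: 175/179 open TAM-DEFECT₂♭ unit rows
of X4 ∧ r0 ∧ surj at `p ≥ 5` have `ord_p ∏ c = 2` (V26-YIELD). Nothing booked; X4 CONSTRUCTION-SHAPED.
[cite: Kim2022StructureSelmer, Thm. 1.9 (6) and Conj. 1.10 (PDF p. 8)] [cite: SilvermanAEC2009, Thm. X.4.14]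
[cite: Miller2011LMS, §1 and Def. 1.1] -/
theorem bsdp_of_plusSymbolLevelLowersAt_of_tamagawa_le_two_of_shaAn_unit_of_five_le
    (hKimk : Kim2026.rankZero_le_padicValNat_sha_of_kuriharaNumber_ne_zero)
    (hE67c : Kim2026.rankZero_padicValNat_sha_add_le_of_forall_pow_dvd_kuriharaNumber_cyclicLevel)
    (hCT : exists_casselsTate_pairing (K := ℚ))
    (hGZK : rank_eq_analyticRank_of_analyticRank_le_one) (hmod : hasEntireLFunction_rat)
    (hp : 5 ≤ p) (hr : W.analyticRank = 0) (hsurj : W.HasSurjectiveModNGaloisRep p)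
    {N : ℕ} [NeZero N] (D : ModularParametrizationData W N) (hN : W.conductorNorm ℤ = N)
    (hc : ¬ (p : ℤ) ∣ D.maninConstant)
    (hper : ∃ u : ℚ, ‖(u : ℚ_[p])‖ = 1 ∧ W.realPeriodRat = u * plusPeriod D.f)
    {q' : ℚ} (hq' : shaAn W = (q' : ℂ)) (hv : padicValRat p q' = 0)
    {ℓ : ℕ} (hcert : PlusSymbolLevelLowersAt W p D.f ℓ) (hℓ : ℓ ∣ W.conductorNorm ℤ)
    (hc2 : padicValNat p W.tamagawaProduct ≤ 2) : BSDp W p := by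
  have hirr := hasIrreducibleModPGaloisRep_of_hasSurjectiveModNGaloisRep W p hsurj
  have h1 : (1 : ℕ∞) ≤ kuriharaPartialInfty W p D.f :=
    one_le_kuriharaPartialInfty_of_plusSymbolLevelLowersAt (by omega) hirr D hN hcert hℓ
  exact bsdp_of_le_kimDefect_of_tamagawa_le_add_one_of_shaAn_unit W p hKimk hE67c hCT hGZK hmod hp hr
    hsurj D hN hc hper hq' hv (α := 1) (by exact_mod_cast h1) (by omega)

/-- **The TAM-DEFECT₂♭ closure at `p ≥ 5` on an OPTIMAL conductor-level datum** (period transfer by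
optimality, `X4.periodTransfer_of_optimal`): the census shape — Cremona optimality, one class integer
`c` with `p ∤ c`, `surj(p)`, `#Ш_an` unit, `ord_p ∏ c ≤ 2`, and the level-lowering certificate.
[cite: Kim2022StructureSelmer, Thm. 1.9 (6) and Conj. 1.10 (PDF p. 8)] [cite: SilvermanAEC2009, Thm. X.4.14]
[cite: Miller2011LMS, §1 and Def. 1.1] [cite: CremonaAlgorithms1997, §2.8 (p. 26)] -/
theorem bsdp_of_plusSymbolLevelLowersAt_of_tamagawa_le_two_of_shaAn_unit_of_optimal_of_five_le
    (hKimk : Kim2026.rankZero_le_padicValNat_sha_of_kuriharaNumber_ne_zero)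
    (hE67c : Kim2026.rankZero_padicValNat_sha_add_le_of_forall_pow_dvd_kuriharaNumber_cyclicLevel)
    (hCT : exists_casselsTate_pairing (K := ℚ))
    (hGZK : rank_eq_analyticRank_of_analyticRank_le_one) (hmod : hasEntireLFunction_rat)
    (hp : 5 ≤ p) (hr : W.analyticRank = 0) (hsurj : W.HasSurjectiveModNGaloisRep p)
    {N : ℕ} [NeZero N] (D : ModularParametrizationData W N) (hN : W.conductorNorm ℤ = N)
    (hopt : ∀ z ∈ D.L.lattice, ∃ w ∈ periodLattice D.f, z = D.c * w)
    (hc : ¬ (p : ℤ) ∣ D.maninConstant)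
    {q' : ℚ} (hq' : shaAn W = (q' : ℂ)) (hv : padicValRat p q' = 0)
    {ℓ : ℕ} (hcert : PlusSymbolLevelLowersAt W p D.f ℓ) (hℓ : ℓ ∣ W.conductorNorm ℤ)
    (hc2 : padicValNat p W.tamagawaProduct ≤ 2) : BSDp W p :=
  bsdp_of_plusSymbolLevelLowersAt_of_tamagawa_le_two_of_shaAn_unit_of_five_le W p hKimk hE67c hCT hGZK
    hmod hp hr hsurj D hN hc (periodTransfer_of_optimal p D hopt hc) hq' hv hcert hℓ hc2

/-! ### §2 `p ≥ 3` tower rows (N11 at `p = 3`), CONDITIONAL on the announced Kim 2025 clause -/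

/-- **The TAM-DEFECT₂♭ closure at `p ≥ 3` on a unit TOWER row, CONDITIONAL on the preprint** (`hK25s`,
flag `Kim2025-preprint`): analytic rank `0`, `ρ̄_{E,p^n}` onto for all `n`, conductor-level datum `D`
with the period transfer, `#Ш_an = q'` a `p`-unit, `ord_p ∏_v c_v ≤ 2`, and a level-lowering
certificate at some `ℓ ∣ N_E` ⟹ `BSD(E,p)`. At `p = 3` this is the N11 TAM-DEFECT₂♭(3) block with
`ord₃ ∏ c = 2` (8 ‖ 1 window rows / ≈ 2 000 sweep rows), per pair, on one finite certificate.
[claim: Kim2025RefinedTNC, status: under-review]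
[cite: Kim2025RefinedTNC, Thm. 1.1 ("BSD") (ANNOUNCED, OPEN binder)] [cite: SilvermanAEC2009, Thm. X.4.14]
[cite: Kim2022StructureSelmer, Conj. 1.10 (PDF p. 8)] [cite: Miller2011LMS, §1 and Def. 1.1] -/
theorem bsdp_of_plusSymbolLevelLowersAt_of_tamagawa_le_two_of_shaAn_unit_of_kim2025_OPEN
    (hK25s : Kim2025.thm11_kimShaLength_of_integralPeriod_OPEN)
    (hCT : exists_casselsTate_pairing (K := ℚ))
    (hGZK : rank_eq_analyticRank_of_analyticRank_le_one) (hmod : hasEntireLFunction_rat)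
    (hp3 : 3 ≤ p) (hr : W.analyticRank = 0) (htower : ∀ n : ℕ, W.HasSurjectiveModNGaloisRep (p ^ n : ℕ))
    {N : ℕ} [NeZero N] (D : ModularParametrizationData W N) (hN : W.conductorNorm ℤ = N)
    (hper : ∃ u : ℚ, ‖(u : ℚ_[p])‖ = 1 ∧ W.realPeriodRat = u * plusPeriod D.f)
    {q' : ℚ} (hq' : shaAn W = (q' : ℂ)) (hv : padicValRat p q' = 0)
    {ℓ : ℕ} (hcert : PlusSymbolLevelLowersAt W p D.f ℓ) (hℓ : ℓ ∣ W.conductorNorm ℤ)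
    (hc2 : padicValNat p W.tamagawaProduct ≤ 2) : BSDp W p := by
  have hsurj : W.HasSurjectiveModNGaloisRep p := by simpa using htower 1
  have hirr := hasIrreducibleModPGaloisRep_of_hasSurjectiveModNGaloisRep W p hsurj
  have h1 : (1 : ℕ∞) ≤ kuriharaPartialInfty W p D.f :=
    one_le_kuriharaPartialInfty_of_plusSymbolLevelLowersAt (by omega) hirr D hN hcert hℓ
  exact Additive.bsdp_of_le_kimDefect_of_tamagawa_le_add_one_of_shaAn_unit_of_kim2025_OPEN W p hK25s
    hCT hGZK hmod hp3 hr htower D hper hq' hv (α := 1) (by exact_mod_cast h1) (by omega)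

/-- **The `p ≥ 3` closure on an OPTIMAL conductor-level datum with `p ∤ c`, CONDITIONAL on the
preprint** — the census shape for Cremona's optimal curves at `3` (tower bit from a `j`-witness /
I₀* / surj(9) certificate upstream; `3 ∤ c` from the Manin table; the level-lowering certificate from
the seat's instrument). [claim: Kim2025RefinedTNC, status: under-review]
[cite: Kim2025RefinedTNC, Thm. 1.1 ("BSD") (ANNOUNCED, OPEN binder)] [cite: SilvermanAEC2009, Thm. X.4.14]
[cite: CremonaAlgorithms1997, §2.8 (p. 26)] -/
theorem bsdp_of_plusSymbolLevelLowersAt_of_tamagawa_le_two_of_shaAn_unit_of_optimal_of_kim2025_OPEN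
    (hK25s : Kim2025.thm11_kimShaLength_of_integralPeriod_OPEN)
    (hCT : exists_casselsTate_pairing (K := ℚ))
    (hGZK : rank_eq_analyticRank_of_analyticRank_le_one) (hmod : hasEntireLFunction_rat)
    (hp3 : 3 ≤ p) (hr : W.analyticRank = 0) (htower : ∀ n : ℕ, W.HasSurjectiveModNGaloisRep (p ^ n : ℕ))
    {N : ℕ} [NeZero N] (D : ModularParametrizationData W N) (hN : W.conductorNorm ℤ = N)
    (hopt : ∀ z ∈ D.L.lattice, ∃ w ∈ periodLattice D.f, z = D.c * w)
    (hc : ¬ (p : ℤ) ∣ D.maninConstant)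
    {q' : ℚ} (hq' : shaAn W = (q' : ℂ)) (hv : padicValRat p q' = 0)
    {ℓ : ℕ} (hcert : PlusSymbolLevelLowersAt W p D.f ℓ) (hℓ : ℓ ∣ W.conductorNorm ℤ)
    (hc2 : padicValNat p W.tamagawaProduct ≤ 2) : BSDp W p :=
  bsdp_of_plusSymbolLevelLowersAt_of_tamagawa_le_two_of_shaAn_unit_of_kim2025_OPEN W p hK25s hCT hGZK
    hmod hp3 hr htower D hN (periodTransfer_of_optimal p D hopt hc) hq' hv hcert hℓ hc2

/-! ### §3 Instrument scope (class-free): no unit Kurihara number under a certificate -/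

/-- **Under a level-lowering certificate NO cyclic-level Kurihara number is a `p`-adic unit**
(`¬ KuriharaUnitAt W p D.f`; `p` odd, `E[p]` irreducible, conductor-level datum): `∂^{(∞)} ≥ 1 ≠ 0`.
So on a row with `p ∣ c_ℓ` at a split multiplicative `ℓ` whose symbol level-lowers, the LOWER-half
instrument "find a unit `δ̃_n`" can never fire at level `k = 1`; the LOWER half there needs a
level-`k ≥ 2` certificate (a `δ̃_n` of exact valuation `ord_p ∏ c` mod `p^k`). Mazur–Rubin's
Prop. 6.2.6 ("`κ^{Kato}` is not primitive when `p ∣ c_ℓ`") is the Galois-side shadow of this.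
[cite: MazurRubin2004, Prop. 6.2.6] [cite: Kim2022StructureSelmer, §1.5.1 (PDF p. 7) and Rem. 6.2 (PDF p. 31)] -/
theorem not_kuriharaUnitAt_of_plusSymbolLevelLowersAt (hp2 : p ≠ 2)
    (hirr : W.HasIrreducibleModPGaloisRep p)
    {N : ℕ} [NeZero N] (D : ModularParametrizationData W N) (hN : W.conductorNorm ℤ = N)
    {ℓ : ℕ} (hcert : PlusSymbolLevelLowersAt W p D.f ℓ) (hℓ : ℓ ∣ W.conductorNorm ℤ) :
    ¬ KuriharaUnitAt W p D.f := by
  rw [kuriharaUnitAt_iff_kuriharaPartialInfty_eq_zero]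
  intro h0
  have h1 := one_le_kuriharaPartialInfty_of_plusSymbolLevelLowersAt hp2 hirr D hN hcert hℓ
  rw [h0] at h1
  exact absurd h1 (by norm_num)

/-! ### §4 E1 PREDICTION on certified rows: Kim's Conjecture 1.10 holds EXACTLY (`∂^{(∞)} = ord_p ∏ c`) -/

/-- **On a certified unit row with `ord_p ∏_v c_v ≤ 2` (`p ≥ 5`), Kim's Conjecture 1.10 HOLDS at the
pair**: `KimTamagawaDefectAt W p D.f`, i.e. `∂^{(∞)}(δ̃_{D.f}) = ord_p ∏_v c_v` EXACTLY — from §1's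
`BSD(E,p)` and gen 17's iff `bsdp_iff_kimTamagawaDefectAt_of_kimFacts_of_five_le` (PUBLISHED inputs).
E1 reading for the Kurihara lanes: on such a row EVERY cyclic-level `δ̃_n^{(k)}` is divisible by
`p^{min(ord_p ∏c, k)}` AND some cyclic level carries a Kurihara number of valuation exactly `ord_p ∏c`
— a pre-registrable prediction at levels `k ≥ 2` (mod `p²`), not only "`≡ 0 (mod p)`".
[cite: Kim2022StructureSelmer, Thm. 1.9 (6) and Conj. 1.10 (PDF p. 8)] [cite: SilvermanAEC2009, Thm. X.4.14]
[cite: Miller2011LMS, §1 and Def. 1.1] -/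
theorem kimTamagawaDefectAt_of_plusSymbolLevelLowersAt_of_tamagawa_le_two_of_shaAn_unit_of_five_le
    (hKimk : Kim2026.rankZero_le_padicValNat_sha_of_kuriharaNumber_ne_zero)
    (hE67c : Kim2026.rankZero_padicValNat_sha_add_le_of_forall_pow_dvd_kuriharaNumber_cyclicLevel)
    (hCT : exists_casselsTate_pairing (K := ℚ))
    (hGZK : rank_eq_analyticRank_of_analyticRank_le_one) (hmod : hasEntireLFunction_rat)
    (hp : 5 ≤ p) (hr : W.analyticRank = 0) (hsurj : W.HasSurjectiveModNGaloisRep p)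
    {N : ℕ} [NeZero N] (D : ModularParametrizationData W N) (hN : W.conductorNorm ℤ = N)
    (hc : ¬ (p : ℤ) ∣ D.maninConstant)
    (hper : ∃ u : ℚ, ‖(u : ℚ_[p])‖ = 1 ∧ W.realPeriodRat = u * plusPeriod D.f)
    {q' : ℚ} (hq' : shaAn W = (q' : ℂ)) (hv : padicValRat p q' = 0)
    {ℓ : ℕ} (hcert : PlusSymbolLevelLowersAt W p D.f ℓ) (hℓ : ℓ ∣ W.conductorNorm ℤ)
    (hc2 : padicValNat p W.tamagawaProduct ≤ 2) : KimTamagawaDefectAt W p D.f :=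
  (bsdp_iff_kimTamagawaDefectAt_of_kimFacts_of_five_le W p hKimk hE67c hGZK hmod hp hr hsurj D hN hc
    hper).mp
    (bsdp_of_plusSymbolLevelLowersAt_of_tamagawa_le_two_of_shaAn_unit_of_five_le W p hKimk hE67c hCT
      hGZK hmod hp hr hsurj D hN hc hper hq' hv hcert hℓ hc2)

/-- **`∂^{(∞)}(δ̃) = 2` on a certified unit row with `ord_p ∏_v c_v = 2`** (`p ≥ 5`, PUBLISHED inputs +
certificate): the TAM-DEFECT₂♭ rows of V26-YIELD, read as an exact valuation statement — all cyclic
Kurihara numbers vanish mod `p²` at levels `k ≥ 2`, and one has valuation exactly `2`.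
[cite: Kim2022StructureSelmer, Conj. 1.10 (PDF p. 8)] -/
theorem kuriharaPartialInfty_eq_two_of_plusSymbolLevelLowersAt_of_shaAn_unit_of_five_le
    (hKimk : Kim2026.rankZero_le_padicValNat_sha_of_kuriharaNumber_ne_zero)
    (hE67c : Kim2026.rankZero_padicValNat_sha_add_le_of_forall_pow_dvd_kuriharaNumber_cyclicLevel)
    (hCT : exists_casselsTate_pairing (K := ℚ))
    (hGZK : rank_eq_analyticRank_of_analyticRank_le_one) (hmod : hasEntireLFunction_rat)
    (hp : 5 ≤ p) (hr : W.analyticRank = 0) (hsurj : W.HasSurjectiveModNGaloisRep p)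
    {N : ℕ} [NeZero N] (D : ModularParametrizationData W N) (hN : W.conductorNorm ℤ = N)
    (hc : ¬ (p : ℤ) ∣ D.maninConstant)
    (hper : ∃ u : ℚ, ‖(u : ℚ_[p])‖ = 1 ∧ W.realPeriodRat = u * plusPeriod D.f)
    {q' : ℚ} (hq' : shaAn W = (q' : ℂ)) (hv : padicValRat p q' = 0)
    {ℓ : ℕ} (hcert : PlusSymbolLevelLowersAt W p D.f ℓ) (hℓ : ℓ ∣ W.conductorNorm ℤ)
    (hc2 : padicValNat p W.tamagawaProduct = 2) : kuriharaPartialInfty W p D.f = 2 := by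
  have h := kimTamagawaDefectAt_of_plusSymbolLevelLowersAt_of_tamagawa_le_two_of_shaAn_unit_of_five_le
    W p hKimk hE67c hCT hGZK hmod hp hr hsurj D hN hc hper hq' hv hcert hℓ hc2.le
  rw [KimTamagawaDefectAt] at h
  rw [h, hc2]
  rfl

/-- **The `p ≥ 3` tower twin, CONDITIONAL on the preprint**: on a certified unit tower row with
`ord_p ∏_v c_v ≤ 2`, Kim's Conjecture 1.10 holds at the pair modulo `Kim2025…_OPEN` — at `p = 3` the
E1 prediction for KURX / E2-AT3 on the 8 window TAM-DEFECT₂♭(3) rows: EVERY cyclic `δ̃_n` vanishes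
mod `9` at the levels `n ∈ 𝒩_2`, and some cyclic level has valuation exactly `2`.
[claim: Kim2025RefinedTNC, status: under-review]
[cite: Kim2025RefinedTNC, Thm. 1.1 ("BSD") (ANNOUNCED, OPEN binder)] [cite: Kim2022StructureSelmer, Conj. 1.10 (PDF p. 8)] -/
theorem kimTamagawaDefectAt_of_plusSymbolLevelLowersAt_of_tamagawa_le_two_of_shaAn_unit_of_kim2025_OPEN
    (hK25s : Kim2025.thm11_kimShaLength_of_integralPeriod_OPEN)
    (hCT : exists_casselsTate_pairing (K := ℚ))
    (hGZK : rank_eq_analyticRank_of_analyticRank_le_one) (hmod : hasEntireLFunction_rat)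
    (hp3 : 3 ≤ p) (hr : W.analyticRank = 0) (htower : ∀ n : ℕ, W.HasSurjectiveModNGaloisRep (p ^ n : ℕ))
    {N : ℕ} [NeZero N] (D : ModularParametrizationData W N) (hN : W.conductorNorm ℤ = N)
    (hper : ∃ u : ℚ, ‖(u : ℚ_[p])‖ = 1 ∧ W.realPeriodRat = u * plusPeriod D.f)
    {q' : ℚ} (hq' : shaAn W = (q' : ℂ)) (hv : padicValRat p q' = 0)
    {ℓ : ℕ} (hcert : PlusSymbolLevelLowersAt W p D.f ℓ) (hℓ : ℓ ∣ W.conductorNorm ℤ)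
    (hc2 : padicValNat p W.tamagawaProduct ≤ 2) : KimTamagawaDefectAt W p D.f := by
  have hp2 : p ≠ 2 := by omega
  have hint := Additive.forall_padicValRat_ratPlusSymbol_nonneg_of_towerSurj hp2 D.isNewformOf htower
  exact (Additive.bsdp_iff_kimTamagawaDefectAt_of_kim2025_OPEN W p hK25s hGZK hmod hp3 hr htower D hper
    hint).mp
    (bsdp_of_plusSymbolLevelLowersAt_of_tamagawa_le_two_of_shaAn_unit_of_kim2025_OPEN W p hK25s hCT
      hGZK hmod hp3 hr htower D hN hper hq' hv hcert hℓ hc2)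

end Summit.BirchSwinnertonDyer.Rank1Residual.X4

end
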